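import Literature.Probability.Percolation.TriLatticeSegments
import Mathlib.Analysis.Convex.Topology
import HarnessLib

/-!
# Closed faces of the triangular lattice in lattice coordinates

Topic `Literature/Probability/Percolation`. Elementary affine geometry of the closed triangular
faces ("cells") of the equilateral embedding of `𝕋`, in the lattice coordinates `triX`, `triY`
of `TriLatticeSegments.lean`, as needed to follow a continuous planar path from cell to cell
(the boundary bookkeeping of the multiple-crossing estimate for the site-percolation
exploration path, `TriExplorationBoundary.lean`):

* `cellForm F j` — the three barycentric coordinates of a point with respect to the face `F`
  (affine forms; `cellForm F j` vanishes on the side opposite... rather *spanned by* the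
  vertices `j + 1`, `j + 2` of the anticlockwise labelling `faceVertex` of
  `TriDiscreteDomain.lean`), `sum_cellForm` (`= 1`) and the barycentric identity `baryc_eq`;
* `triCell F = {∀ j, 0 ≤ cellForm F j}` (the closed face), `triCellStrict F` (the open face):
  vertices and sides lie in the cell, the cell is convex, closed and bounded, the open face is
  open, the frontier of the cell lies in the union of its three sides
  (`frontier_triCell_subset`), a cell point with a vanishing form lies on the corresponding
  side (`mem_side_of_cellForm_eq_zero`);
* `exists_mem_triCell` — the cells cover the plane; `eq_of_mem_triCellStrict_of_mem_triCell` —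
  a point of an open face lies in no other cell; hence two distinct cells meet only along sides
  (`exists_side_of_mem_triCell_of_ne`);
* `exists_ball_triCell_subset` — upper semicontinuity of the set of cells containing a point:
  all cells containing a point close enough to `z` contain `z`.

Everything is folklore (proved by lattice coordinates).
-/

noncomputable section

open Complex Set Metric

namespace Literature.Probability.Percolation

open LatticeModels

/-! ### Barycentric coordinates of the faces -/

/-- The three **barycentric coordinates** with respect to the face `F`, as affine forms of the
plane in lattice coordinates: for the up face of the cell `x` they are
`x₀ + x₁ + 1 - (X + Y)`, `X - x₀`, `Y - x₁`, for the down face `x₁ + 1 - Y`,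
`X + Y - (x₀ + x₁ + 1)`, `x₀ + 1 - X`; the `j`-th one is the weight of the vertex
`faceVertex F j` (`baryc_eq`) and vanishes on the side spanned by the two other vertices.
[folklore] -/
def cellForm (F : HexVertex) (j : Fin 3) (z : ℂ) : ℝ :=
  if F.2 = 0 then ![((F.1 0 : ℝ) + F.1 1 + 1) - (triX z + triY z), triX z - F.1 0, triY z - F.1 1] j
  else ![((F.1 1 : ℝ) + 1) - triY z, (triX z + triY z) - ((F.1 0 : ℝ) + F.1 1 + 1), ((F.1 0 : ℝ) + 1) - triX z] j

/-- Case analysis on the type of a face. [folklore] -/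
theorem HexVertex.snd_eq_zero_or_one (F : HexVertex) : F.2 = 0 ∨ F.2 = 1 := by
  rcases Fin.exists_fin_two.1 ⟨F.2, rfl⟩ with h | h
  · exact Or.inl h
  · exact Or.inr h

/-- The barycentric coordinates sum to `1`. [folklore] -/
theorem sum_cellForm (F : HexVertex) (z : ℂ) : cellForm F 0 z + cellForm F 1 z + cellForm F 2 z = 1 := by
  rcases F with ⟨x, t⟩
  rcases HexVertex.snd_eq_zero_or_one (x, t) with ht | ht <;> simp only at ht <;> subst ht <;>
    simp [cellForm] <;> ring

/-- The barycentric coordinates are affine. [folklore] -/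
theorem cellForm_lineComb (F : HexVertex) (j : Fin 3) {a b : ℝ} (hab : a + b = 1) (z z' : ℂ) :
    cellForm F j ((a : ℂ) * z + (b : ℂ) * z') = a * cellForm F j z + b * cellForm F j z' := by
  have hX : triX ((a : ℂ) * z + (b : ℂ) * z') = a * triX z + b * triX z' := by
    rw [triX_add, triX_smul, triX_smul]
  have hY : triY ((a : ℂ) * z + (b : ℂ) * z') = a * triY z + b * triY z' := by
    rw [triY_add, triY_smul, triY_smul]
  obtain rfl : b = 1 - a := by linarith
  rcases F with ⟨x, t⟩
  rcases HexVertex.snd_eq_zero_or_one (x, t) with ht | ht <;> simp only at ht <;> subst ht <;>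
    obtain rfl | rfl | rfl : j = 0 ∨ j = 1 ∨ j = 2 := (by fin_cases j <;> simp) <;>
    simp only [cellForm, Fin.isValue, ↓reduceIte, one_ne_zero, Matrix.cons_val_zero, Matrix.cons_val_one,
      Matrix.cons_val_two, Matrix.head_cons, Matrix.tail_cons, hX, hY] <;>
    ring

/-- Coordinates of the anticlockwise vertices of a face. [folklore] -/
theorem faceVertex_coords (F : HexVertex) (k : Fin 3) :
    ((faceVertex F k 0 : ℤ) : ℝ) = (if F.2 = 0 then ![(F.1 0 : ℝ), F.1 0 + 1, F.1 0] k
        else ![(F.1 0 : ℝ) + 1, F.1 0 + 1, F.1 0] k) ∧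
      ((faceVertex F k 1 : ℤ) : ℝ) = (if F.2 = 0 then ![(F.1 1 : ℝ), F.1 1, F.1 1 + 1] k
        else ![(F.1 1 : ℝ), F.1 1 + 1, F.1 1 + 1] k) := by
  rcases F with ⟨x, t⟩
  rcases HexVertex.snd_eq_zero_or_one (x, t) with ht | ht <;> simp only at ht <;> subst ht <;>
    obtain rfl | rfl | rfl : k = 0 ∨ k = 1 ∨ k = 2 := (by fin_cases k <;> simp) <;>
    simp [faceVertex]

/-- **The barycentric identity**: every point of the plane is the combination of the three
vertices of `F` with weights its barycentric coordinates. [folklore] -/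
theorem baryc_eq (F : HexVertex) (z : ℂ) :
    z = (cellForm F 0 z : ℂ) * triEmbed (faceVertex F 0) + (cellForm F 1 z : ℂ) * triEmbed (faceVertex F 1) +
      (cellForm F 2 z : ℂ) * triEmbed (faceVertex F 2) := by
  have h0 := faceVertex_coords F 0
  have h1 := faceVertex_coords F 1
  have h2 := faceVertex_coords F 2
  rcases F with ⟨x, t⟩
  rcases HexVertex.snd_eq_zero_or_one (x, t) with ht | ht <;> simp only at ht <;> subst ht <;>
    simp only [Fin.isValue, ↓reduceIte, one_ne_zero, Matrix.cons_val_zero, Matrix.cons_val_one,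
      Matrix.cons_val_two, Matrix.head_cons, Matrix.tail_cons] at h0 h1 h2 <;>
    apply triXY_ext <;>
    simp only [triX_add, triY_add, triX_smul, triY_smul, triX_triEmbed, triY_triEmbed, h0.1, h0.2, h1.1, h1.2,
      h2.1, h2.2, cellForm, Fin.isValue, ↓reduceIte, one_ne_zero, Matrix.cons_val_zero, Matrix.cons_val_one,
      Matrix.cons_val_two, Matrix.head_cons, Matrix.tail_cons] <;>
    ring

/-- **The barycentric coordinates of the vertices** are the Kronecker deltas. [folklore] -/
theorem cellForm_faceVertex (F : HexVertex) (j k : Fin 3) :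
    cellForm F j (triEmbed (faceVertex F k)) = if j = k then 1 else 0 := by
  have hk := faceVertex_coords F k
  rcases F with ⟨x, t⟩
  rcases HexVertex.snd_eq_zero_or_one (x, t) with ht | ht <;> simp only at ht <;> subst ht <;>
    obtain rfl | rfl | rfl : k = 0 ∨ k = 1 ∨ k = 2 := (by fin_cases k <;> simp) <;>
    obtain rfl | rfl | rfl : j = 0 ∨ j = 1 ∨ j = 2 := (by fin_cases j <;> simp) <;>
    simp only [Fin.isValue, ↓reduceIte, one_ne_zero, Matrix.cons_val_zero, Matrix.cons_val_one,
      Matrix.cons_val_two, Matrix.head_cons, Matrix.tail_cons] at hk <;>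
    simp only [cellForm, triX_triEmbed, triY_triEmbed, hk.1, hk.2, Fin.isValue, ↓reduceIte, one_ne_zero,
      Matrix.cons_val_zero, Matrix.cons_val_one, Matrix.cons_val_two, Matrix.head_cons, Matrix.tail_cons] <;>
    (try split_ifs with hjk) <;>
    first | ring1 | exact absurd hjk (by decide)

/-! ### The closed and the open face -/

/-- The **closed face** (cell) `F` of `𝕋`: the points with nonnegative barycentric coordinates.
[folklore] -/
def triCell (F : HexVertex) : Set ℂ := {z | ∀ j, 0 ≤ cellForm F j z}

/-- The **open face** `F`: the points with positive barycentric coordinates. [folklore] -/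
def triCellStrict (F : HexVertex) : Set ℂ := {z | ∀ j, 0 < cellForm F j z}

/-- The `j`-th **side** of the face `F`: the closed unit edge spanned by the vertices `j + 1` and
`j + 2` (across which lies `oppFace F j`). [folklore] -/
def triSide (F : HexVertex) (j : Fin 3) : Set ℂ :=
  segment ℝ (triEmbed (faceVertex F (j + 1))) (triEmbed (faceVertex F (j + 2)))

/-- Membership in the cell, unfolded. [folklore] -/
theorem mem_triCell_iff {F : HexVertex} {z : ℂ} : z ∈ triCell F ↔ ∀ j, 0 ≤ cellForm F j z := Iff.rfl

/-- Membership in the open face, unfolded. [folklore] -/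
theorem mem_triCellStrict_iff {F : HexVertex} {z : ℂ} : z ∈ triCellStrict F ↔ ∀ j, 0 < cellForm F j z := Iff.rfl

/-- The open face lies in the cell. [folklore] -/
theorem triCellStrict_subset_triCell (F : HexVertex) : triCellStrict F ⊆ triCell F :=
  fun _ hz j ↦ (hz j).le

/-- The vertices lie in the cell. [folklore] -/
theorem triEmbed_faceVertex_mem_triCell (F : HexVertex) (k : Fin 3) : triEmbed (faceVertex F k) ∈ triCell F := by
  intro j
  rw [cellForm_faceVertex]
  split_ifs <;> norm_num

/-- The cell is convex. [folklore] -/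
theorem convex_triCell (F : HexVertex) : Convex ℝ (triCell F) := by
  intro z hz z' hz' a b ha hb hab j
  rw [Complex.real_smul, Complex.real_smul, cellForm_lineComb F j hab]
  exact add_nonneg (mul_nonneg ha (hz j)) (mul_nonneg hb (hz' j))

/-- The sides lie in the cell. [folklore] -/
theorem triSide_subset_triCell (F : HexVertex) (j : Fin 3) : triSide F j ⊆ triCell F :=
  (convex_triCell F).segment_subset (triEmbed_faceVertex_mem_triCell F _) (triEmbed_faceVertex_mem_triCell F _)

/-- **A cell point with a vanishing barycentric coordinate lies on the corresponding side.**
[folklore] -/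
theorem mem_triSide_of_cellForm_eq_zero {F : HexVertex} {z : ℂ} {j : Fin 3} (hz : z ∈ triCell F)
    (h0 : cellForm F j z = 0) : z ∈ triSide F j := by
  have hsum := sum_cellForm F z
  have hbar := baryc_eq F z
  obtain rfl | rfl | rfl : j = 0 ∨ j = 1 ∨ j = 2 := by fin_cases j <;> simp
  · refine ⟨cellForm F 1 z, cellForm F 2 z, hz 1, hz 2, by rw [h0] at hsum; linarith, ?_⟩
    rw [Complex.real_smul, Complex.real_smul]
    rw [h0] at hbar
    change (cellForm F 1 z : ℂ) * triEmbed (faceVertex F (0 + 1)) +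
      (cellForm F 2 z : ℂ) * triEmbed (faceVertex F (0 + 2)) = z
    rw [show (0 : Fin 3) + 1 = 1 from rfl, show (0 : Fin 3) + 2 = 2 from rfl]
    exact (hbar.trans (by push_cast; ring)).symm
  · refine ⟨cellForm F 2 z, cellForm F 0 z, hz 2, hz 0, by rw [h0] at hsum; linarith, ?_⟩
    rw [Complex.real_smul, Complex.real_smul]
    rw [h0] at hbar
    change (cellForm F 2 z : ℂ) * triEmbed (faceVertex F (1 + 1)) +
      (cellForm F 0 z : ℂ) * triEmbed (faceVertex F (1 + 2)) = z
    rw [show (1 : Fin 3) + 1 = 2 from rfl, show (1 : Fin 3) + 2 = 0 from rfl]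
    exact (hbar.trans (by push_cast; ring)).symm
  · refine ⟨cellForm F 0 z, cellForm F 1 z, hz 0, hz 1, by rw [h0] at hsum; linarith, ?_⟩
    rw [Complex.real_smul, Complex.real_smul]
    rw [h0] at hbar
    change (cellForm F 0 z : ℂ) * triEmbed (faceVertex F (2 + 1)) +
      (cellForm F 1 z : ℂ) * triEmbed (faceVertex F (2 + 2)) = z
    rw [show (2 : Fin 3) + 1 = 0 from rfl, show (2 : Fin 3) + 2 = 1 from rfl]
    exact (hbar.trans (by push_cast; ring)).symm

/-- `triX` is continuous. [folklore] -/
theorem continuous_triX : Continuous triX := by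
  unfold triX; fun_prop

/-- `triY` is continuous. [folklore] -/
theorem continuous_triY : Continuous triY := by
  unfold triY; fun_prop

/-- The barycentric coordinates are continuous. [folklore] -/
theorem continuous_cellForm (F : HexVertex) (j : Fin 3) : Continuous (cellForm F j) := by
  have hX := continuous_triX
  have hY := continuous_triY
  change Continuous fun z ↦ cellForm F j z
  rcases F with ⟨x, t⟩
  rcases HexVertex.snd_eq_zero_or_one (x, t) with ht | ht <;> simp only at ht <;> subst ht <;>
    obtain rfl | rfl | rfl : j = 0 ∨ j = 1 ∨ j = 2 := (by fin_cases j <;> simp) <;>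
    simp only [cellForm, Fin.isValue, ↓reduceIte, one_ne_zero, Matrix.cons_val_zero, Matrix.cons_val_one,
      Matrix.cons_val_two, Matrix.head_cons, Matrix.tail_cons] <;>
    fun_prop

/-- The cell is closed. [folklore] -/
theorem isClosed_triCell (F : HexVertex) : IsClosed (triCell F) := by
  have : triCell F = ⋂ j, {z | 0 ≤ cellForm F j z} := by ext z; simp [triCell]
  rw [this]
  exact isClosed_iInter fun j ↦ isClosed_le continuous_const (continuous_cellForm F j)

/-- The open face is open. [folklore] -/
theorem isOpen_triCellStrict (F : HexVertex) : IsOpen (triCellStrict F) := by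
  have : triCellStrict F = ⋂ j, {z | 0 < cellForm F j z} := by ext z; simp [triCellStrict]
  rw [this]
  exact isOpen_iInter_of_finite fun j ↦ isOpen_lt continuous_const (continuous_cellForm F j)

/-- The open face lies in the interior of the cell. [folklore] -/
theorem triCellStrict_subset_interior (F : HexVertex) : triCellStrict F ⊆ interior (triCell F) :=
  interior_maximal (triCellStrict_subset_triCell F) (isOpen_triCellStrict F)

/-- A cell point outside the open face lies on a side. [folklore] -/
theorem exists_mem_triSide_of_not_mem_triCellStrict {F : HexVertex} {z : ℂ} (hz : z ∈ triCell F)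
    (hs : z ∉ triCellStrict F) : ∃ j, z ∈ triSide F j := by
  simp only [mem_triCellStrict_iff, not_forall, not_lt] at hs
  obtain ⟨j, hj⟩ := hs
  exact ⟨j, mem_triSide_of_cellForm_eq_zero hz (le_antisymm hj (hz j))⟩

/-- **The frontier of a cell lies in the union of its sides.** [folklore] -/
theorem frontier_triCell_subset (F : HexVertex) : frontier (triCell F) ⊆ ⋃ j, triSide F j := by
  intro z hz
  rw [frontier, (isClosed_triCell F).closure_eq] at hz
  obtain ⟨j, hj⟩ := exists_mem_triSide_of_not_mem_triCellStrict hz.1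
    (fun h ↦ hz.2 (triCellStrict_subset_interior F h))
  exact mem_iUnion.2 ⟨j, hj⟩

/-- `‖ζ‖ = 1` (private copy of `SmirnovSeparatingData.norm_triZeta`). [folklore] -/
private theorem norm_triZeta_eq_one' : ‖triZeta‖ = 1 := by
  have h := normSq_triZeta
  rw [Complex.normSq_eq_norm_sq] at h
  nlinarith [norm_nonneg triZeta, h]

/-- The vertices of a face are within `2` of the lattice point of its cell. [folklore] -/
theorem norm_triEmbed_faceVertex_sub_le (F : HexVertex) (k : Fin 3) :
    ‖triEmbed (faceVertex F k) - triEmbed F.1‖ ≤ 2 := by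
  have h1 : ‖triEmbed (Pi.single 0 1 : Site 2)‖ ≤ 2 := by
    simp [triEmbed]
  have h2 : ‖triEmbed (Pi.single 1 1 : Site 2)‖ ≤ 2 := by
    simp [triEmbed, norm_triZeta_eq_one']
  have h3 : ‖triEmbed (Pi.single 0 1 + Pi.single 1 1 : Site 2)‖ ≤ 2 := by
    rw [triEmbed_add]
    refine (norm_add_le _ _).trans ?_
    simp [triEmbed, norm_triZeta_eq_one']
    norm_num
  rcases F with ⟨x, t⟩
  rcases HexVertex.snd_eq_zero_or_one (x, t) with ht | ht <;> simp only at ht <;> subst ht <;>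
    obtain rfl | rfl | rfl : k = 0 ∨ k = 1 ∨ k = 2 := (by fin_cases k <;> simp) <;>
    simp only [faceVertex, Fin.isValue, ↓reduceIte, one_ne_zero, Matrix.cons_val_zero, Matrix.cons_val_one,
      Matrix.cons_val_two, Matrix.head_cons, Matrix.tail_cons, add_assoc, ← triEmbed_sub, add_sub_cancel_left,
      sub_self, norm_zero] <;>
    first | exact h1 | exact h2 | exact h3 | norm_num

/-- **A cell lies within `2` of the lattice point of its cell** (a convex combination of the
vertices). [folklore] -/
theorem norm_sub_triEmbed_le_of_mem_triCell {F : HexVertex} {z : ℂ} (hz : z ∈ triCell F) :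
    ‖z - triEmbed F.1‖ ≤ 2 := by
  have hsum := sum_cellForm F z
  have hbar := baryc_eq F z
  set p := triEmbed F.1
  have key : z - p = (cellForm F 0 z : ℂ) * (triEmbed (faceVertex F 0) - p) +
      (cellForm F 1 z : ℂ) * (triEmbed (faceVertex F 1) - p) + (cellForm F 2 z : ℂ) * (triEmbed (faceVertex F 2) - p) := by
    have : (p : ℂ) = ((cellForm F 0 z + cellForm F 1 z + cellForm F 2 z : ℝ) : ℂ) * p := by
      rw [hsum]; push_cast; ring
    conv_lhs => rw [hbar, this]
    push_cast; ring
  rw [key]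
  have hn : ∀ k, ‖(cellForm F k z : ℂ) * (triEmbed (faceVertex F k) - p)‖ ≤ cellForm F k z * 2 := fun k ↦ by
    rw [norm_mul, Complex.norm_real, Real.norm_eq_abs, abs_of_nonneg (hz k)]
    exact mul_le_mul_of_nonneg_left (norm_triEmbed_faceVertex_sub_le F k) (hz k)
  calc _ ≤ ‖(cellForm F 0 z : ℂ) * (triEmbed (faceVertex F 0) - p) + (cellForm F 1 z : ℂ) * (triEmbed (faceVertex F 1) - p)‖
        + ‖(cellForm F 2 z : ℂ) * (triEmbed (faceVertex F 2) - p)‖ := norm_add_le _ _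
    _ ≤ (‖(cellForm F 0 z : ℂ) * (triEmbed (faceVertex F 0) - p)‖ + ‖(cellForm F 1 z : ℂ) * (triEmbed (faceVertex F 1) - p)‖)
        + ‖(cellForm F 2 z : ℂ) * (triEmbed (faceVertex F 2) - p)‖ := by gcongr; exact norm_add_le _ _
    _ ≤ (cellForm F 0 z * 2 + cellForm F 1 z * 2) + cellForm F 2 z * 2 := by gcongr <;> exact hn _
    _ = 2 := by linarith

/-- The cell is bounded. [folklore] -/
theorem isBounded_triCell (F : HexVertex) : Bornology.IsBounded (triCell F) :=
  (isBounded_closedBall (x := triEmbed F.1) (r := 2)).subset fun _ hz ↦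
    mem_closedBall.2 (by rw [dist_eq_norm]; exact norm_sub_triEmbed_le_of_mem_triCell hz)

/-! ### The cells cover the plane and overlap only along sides -/

/-- **Every point lies in a cell**: with `x = (⌊X⌋, ⌊Y⌋)`, in the up face of `x` if the
fractional parts sum to at most `1`, in the down face otherwise. [folklore] -/
theorem exists_mem_triCell (z : ℂ) : ∃ F, z ∈ triCell F := by
  set x : Site 2 := ![⌊triX z⌋, ⌊triY z⌋] with hx
  have hx0 : ((x 0 : ℤ) : ℝ) = ⌊triX z⌋ := by simp [hx]
  have hx1 : ((x 1 : ℤ) : ℝ) = ⌊triY z⌋ := by simp [hx]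
  have f0 := Int.floor_le (triX z)
  have f1 := Int.floor_le (triY z)
  have g0 := Int.lt_floor_add_one (triX z)
  have g1 := Int.lt_floor_add_one (triY z)
  by_cases h : triX z + triY z ≤ ⌊triX z⌋ + ⌊triY z⌋ + 1
  · refine ⟨(x, 0), fun j ↦ ?_⟩
    obtain rfl | rfl | rfl : j = 0 ∨ j = 1 ∨ j = 2 := by fin_cases j <;> simp
    all_goals simp only [cellForm, Fin.isValue, ↓reduceIte, Matrix.cons_val_zero, Matrix.cons_val_one,
      Matrix.cons_val_two, Matrix.head_cons, Matrix.tail_cons, hx0, hx1]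
    all_goals linarith
  · refine ⟨(x, 1), fun j ↦ ?_⟩
    obtain rfl | rfl | rfl : j = 0 ∨ j = 1 ∨ j = 2 := by fin_cases j <;> simp
    all_goals simp only [cellForm, Fin.isValue, ↓reduceIte, one_ne_zero, Matrix.cons_val_zero, Matrix.cons_val_one,
      Matrix.cons_val_two, Matrix.head_cons, Matrix.tail_cons, hx0, hx1]
    all_goals linarith

/-- The lattice coordinates of a point of the open face lie strictly inside the unit windows of
its cell. [folklore] -/
theorem coords_of_mem_triCellStrict {F : HexVertex} {z : ℂ} (hz : z ∈ triCellStrict F) :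
    (F.1 0 : ℝ) < triX z ∧ triX z < F.1 0 + 1 ∧ (F.1 1 : ℝ) < triY z ∧ triY z < F.1 1 + 1 := by
  have h0 := hz 0; have h1 := hz 1; have h2 := hz 2
  rcases F with ⟨x, t⟩
  rcases HexVertex.snd_eq_zero_or_one (x, t) with ht | ht <;> simp only at ht <;> subst ht <;>
    simp only [cellForm, Fin.isValue, ↓reduceIte, one_ne_zero, Matrix.cons_val_zero, Matrix.cons_val_one,
      Matrix.cons_val_two, Matrix.head_cons, Matrix.tail_cons] at h0 h1 h2 ⊢ <;>
    refine ⟨by linarith, by linarith, by linarith, by linarith⟩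

/-- The lattice coordinates of a point of the cell lie in the unit windows of its cell.
[folklore] -/
theorem coords_of_mem_triCell {F : HexVertex} {z : ℂ} (hz : z ∈ triCell F) :
    (F.1 0 : ℝ) ≤ triX z ∧ triX z ≤ F.1 0 + 1 ∧ (F.1 1 : ℝ) ≤ triY z ∧ triY z ≤ F.1 1 + 1 := by
  have h0 := hz 0; have h1 := hz 1; have h2 := hz 2
  rcases F with ⟨x, t⟩
  rcases HexVertex.snd_eq_zero_or_one (x, t) with ht | ht <;> simp only at ht <;> subst ht <;>
    simp only [cellForm, Fin.isValue, ↓reduceIte, one_ne_zero, Matrix.cons_val_zero, Matrix.cons_val_one,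
      Matrix.cons_val_two, Matrix.head_cons, Matrix.tail_cons] at h0 h1 h2 ⊢ <;>
    refine ⟨by linarith, by linarith, by linarith, by linarith⟩

/-- Integer squeeze: `a ≤ X < b + 1` and `b < X ≤ a + 1` force `a = b`. [folklore] -/
theorem Int.eq_of_real_squeeze {a b : ℤ} {X : ℝ} (h1 : (a : ℝ) ≤ X) (h2 : X < b + 1) (h3 : (b : ℝ) < X)
    (h4 : X ≤ a + 1) : a = b := by
  have ha : (a : ℝ) < b + 1 := h1.trans_lt h2
  have hb : (b : ℝ) < a + 1 := h3.trans_le h4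
  have ha' : a < b + 1 := by exact_mod_cast ha
  have hb' : b < a + 1 := by exact_mod_cast hb
  omega

/-- **A point of an open face lies in no other cell.** [folklore] -/
theorem eq_of_mem_triCellStrict_of_mem_triCell {F F' : HexVertex} {z : ℂ} (hz : z ∈ triCellStrict F)
    (hz' : z ∈ triCell F') : F = F' := by
  obtain ⟨a0, a1, b0, b1⟩ := coords_of_mem_triCellStrict hz
  obtain ⟨c0, c1, d0, d1⟩ := coords_of_mem_triCell hz'
  have e0 : F'.1 0 = F.1 0 := Int.eq_of_real_squeeze c0 a1 a0 c1
  have e1 : F'.1 1 = F.1 1 := Int.eq_of_real_squeeze d0 b1 b0 d1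
  have ecell : F.1 = F'.1 := by
    ext i; fin_cases i
    · exact e0.symm
    · exact e1.symm
  -- the types agree: the third constraints are incompatible otherwise
  have h0 := hz 0; have h1 := hz 1; have h2 := hz 2
  have g0 := hz' 0; have g1 := hz' 1; have g2 := hz' 2
  rcases F with ⟨x, t⟩
  rcases F' with ⟨x', t'⟩
  simp only at ecell; subst ecell
  rcases Fin.exists_fin_two.1 ⟨t, rfl⟩ with ht | ht <;> subst ht <;>
    rcases Fin.exists_fin_two.1 ⟨t', rfl⟩ with ht' | ht' <;> subst ht' <;>
    simp only [cellForm, Fin.isValue, ↓reduceIte, one_ne_zero, Matrix.cons_val_zero, Matrix.cons_val_one,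
      Matrix.cons_val_two, Matrix.head_cons, Matrix.tail_cons] at h0 h1 h2 g0 g1 g2 <;>
    first | rfl | (exfalso; linarith)

/-- **Two distinct cells meet only along sides**: a common point lies on a side of each.
[folklore] -/
theorem exists_mem_triSide_of_mem_triCell_of_ne {F F' : HexVertex} {z : ℂ} (hz : z ∈ triCell F)
    (hz' : z ∈ triCell F') (hne : F ≠ F') : ∃ j, z ∈ triSide F j :=
  exists_mem_triSide_of_not_mem_triCellStrict hz fun h ↦ hne (eq_of_mem_triCellStrict_of_mem_triCell h hz')

/-- The endpoints of a side are adjacent in `𝕋`. [folklore] -/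
theorem triGraph_adj_faceVertex_succ (F : HexVertex) (j : Fin 3) :
    triGraph.Adj (faceVertex F (j + 1)) (faceVertex F (j + 2)) := by
  rw [faceVertex_add_two_eq]
  exact triGraph_adj_add_triDir _ _

/-- The endpoints of a side lie on it. [folklore] -/
theorem triEmbed_faceVertex_mem_triSide (F : HexVertex) (j : Fin 3) :
    triEmbed (faceVertex F (j + 1)) ∈ triSide F j ∧ triEmbed (faceVertex F (j + 2)) ∈ triSide F j :=
  ⟨left_mem_segment _ _ _, right_mem_segment _ _ _⟩

/-! ### Upper semicontinuity of the cells containing a point -/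

/-- The gap of a real number to the integers *other than itself*: `1` for an integer, the
distance to the nearest integer otherwise. [folklore] -/
def gapFn (t : ℝ) : ℝ := if (⌊t⌋ : ℝ) = t then 1 else min (Int.fract t) (1 - Int.fract t)

/-- The gap is positive. [folklore] -/
theorem gapFn_pos (t : ℝ) : 0 < gapFn t := by
  unfold gapFn
  split_ifs with h
  · exact one_pos
  · refine lt_min ?_ (by linarith [Int.fract_lt_one t])
    rcases (Int.fract_nonneg t).lt_or_eq with h' | h'
    · exact h'
    · exfalso; apply h
      have := Int.fract_add_floor t
      linarith

/-- **An integer lower bound survives a perturbation smaller than the gap.** [folklore] -/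
theorem int_le_of_abs_sub_lt {t t' : ℝ} {n : ℤ} (hn : (n : ℝ) ≤ t') (h : |t' - t| < gapFn t) : (n : ℝ) ≤ t := by
  by_contra hlt
  rw [not_le] at hlt
  rw [abs_lt] at h
  unfold gapFn at h
  split_ifs at h with hint
  · -- `t` is an integer
    have h1 : ⌊t⌋ < n := by exact_mod_cast hint.symm ▸ hlt
    have h2 : ((⌊t⌋ + 1 : ℤ) : ℝ) ≤ n := by exact_mod_cast h1
    push_cast at h2
    linarith
  · have h1 : ⌊t⌋ < n := Int.floor_lt.2 hlt
    have h2 : ((⌊t⌋ + 1 : ℤ) : ℝ) ≤ n := by exact_mod_cast h1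
    push_cast at h2
    have h3 := Int.fract_add_floor t
    have h4 : min (Int.fract t) (1 - Int.fract t) ≤ 1 - Int.fract t := min_le_right _ _
    linarith

/-- **An integer upper bound survives a perturbation smaller than the gap.** [folklore] -/
theorem le_int_of_abs_sub_lt {t t' : ℝ} {n : ℤ} (hn : t' ≤ n) (h : |t' - t| < gapFn t) : t ≤ n := by
  by_contra hlt
  rw [not_le] at hlt
  rw [abs_lt] at h
  unfold gapFn at h
  split_ifs at h with hint
  · have h1 : n < ⌊t⌋ := by exact_mod_cast hint.symm ▸ hlt
    have h2 : (n : ℝ) ≤ ((⌊t⌋ - 1 : ℤ) : ℝ) := by exact_mod_cast (by omega : n ≤ ⌊t⌋ - 1)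
    push_cast at h2
    linarith
  · have h1 : n ≤ ⌊t⌋ := Int.le_floor.2 hlt.le
    have h2 : (n : ℝ) ≤ ⌊t⌋ := by exact_mod_cast h1
    have h3 := Int.fract_add_floor t
    have h4 : min (Int.fract t) (1 - Int.fract t) ≤ Int.fract t := min_le_left _ _
    linarith

/-- `1 ≤ √3`. [folklore] -/
theorem one_le_sqrt_three : (1 : ℝ) ≤ Real.sqrt 3 := by
  rw [Real.one_le_sqrt]; norm_num

/-- `triX` is `2`-Lipschitz. [folklore] -/
theorem abs_triX_sub_le (z z' : ℂ) : |triX z - triX z'| ≤ 2 * ‖z - z'‖ := by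
  rw [← triX_sub]
  have h3 := one_le_sqrt_three
  have hre := Complex.abs_re_le_norm (z - z')
  have him := Complex.abs_im_le_norm (z - z')
  have h1 : |(z - z').im / Real.sqrt 3| ≤ |(z - z').im| := by
    rw [abs_div, abs_of_pos (by positivity : (0 : ℝ) < Real.sqrt 3)]
    exact div_le_self (abs_nonneg _) h3
  unfold triX
  calc |(z - z').re - (z - z').im / Real.sqrt 3| ≤ |(z - z').re| + |(z - z').im / Real.sqrt 3| := abs_sub _ _
    _ ≤ ‖z - z'‖ + ‖z - z'‖ := add_le_add hre (h1.trans him)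
    _ = 2 * ‖z - z'‖ := by ring

/-- `triY` is `2`-Lipschitz. [folklore] -/
theorem abs_triY_sub_le (z z' : ℂ) : |triY z - triY z'| ≤ 2 * ‖z - z'‖ := by
  rw [← triY_sub]
  have h3 := one_le_sqrt_three
  have him := Complex.abs_im_le_norm (z - z')
  unfold triY
  rw [abs_div, abs_mul, abs_of_pos (by positivity : (0 : ℝ) < Real.sqrt 3), abs_two]
  rw [div_le_iff₀ (by positivity)]
  nlinarith [norm_nonneg (z - z'), abs_nonneg ((z - z').im)]

/-- **Upper semicontinuity of the cells containing a point**: every cell containing a point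
close enough to `z` contains `z` (the three families of lattice lines are locally finite).
[folklore] -/
theorem exists_ball_forall_triCell (z : ℂ) :
    ∃ ε > 0, ∀ z', dist z' z < ε → ∀ F, z' ∈ triCell F → z ∈ triCell F := by
  set g : ℝ := min (gapFn (triX z)) (min (gapFn (triY z)) (gapFn (triX z + triY z))) with hg
  have hgpos : 0 < g := lt_min (gapFn_pos _) (lt_min (gapFn_pos _) (gapFn_pos _))
  refine ⟨g / 4, by positivity, fun z' hz' F hF j ↦ ?_⟩
  rw [dist_eq_norm] at hz'
  have hX : |triX z' - triX z| < gapFn (triX z) := by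
    have := abs_triX_sub_le z' z
    have : g ≤ gapFn (triX z) := min_le_left _ _
    linarith
  have hY : |triY z' - triY z| < gapFn (triY z) := by
    have := abs_triY_sub_le z' z
    have : g ≤ gapFn (triY z) := (min_le_right _ _).trans (min_le_left _ _)
    linarith
  have hXY : |triX z' + triY z' - (triX z + triY z)| < gapFn (triX z + triY z) := by
    have h1 := abs_triX_sub_le z' z
    have h2 := abs_triY_sub_le z' z
    have : g ≤ gapFn (triX z + triY z) := (min_le_right _ _).trans (min_le_right _ _)
    have : |triX z' + triY z' - (triX z + triY z)| ≤ |triX z' - triX z| + |triY z' - triY z| := by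
      rw [show triX z' + triY z' - (triX z + triY z) = (triX z' - triX z) + (triY z' - triY z) by ring]
      exact abs_add_le _ _
    linarith
  have hFj := hF j
  rcases F with ⟨x, t⟩
  rcases HexVertex.snd_eq_zero_or_one (x, t) with ht | ht <;> simp only at ht <;> subst ht <;>
    obtain rfl | rfl | rfl : j = 0 ∨ j = 1 ∨ j = 2 := (by fin_cases j <;> simp) <;>
    simp only [cellForm, Fin.isValue, ↓reduceIte, one_ne_zero, Matrix.cons_val_zero, Matrix.cons_val_one,
      Matrix.cons_val_two, Matrix.head_cons, Matrix.tail_cons, sub_nonneg] at hFj ⊢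
  · exact le_int_of_abs_sub_lt (n := x 0 + x 1 + 1) (by push_cast; exact hFj) hXY |>.trans (by push_cast; rfl)
  · exact int_le_of_abs_sub_lt hFj hX
  · exact int_le_of_abs_sub_lt hFj hY
  · exact le_int_of_abs_sub_lt (n := x 1 + 1) (by push_cast; exact hFj) hY |>.trans (by push_cast; rfl)
  · exact (le_of_eq (by push_cast; rfl)).trans (int_le_of_abs_sub_lt (n := x 0 + x 1 + 1) (by push_cast; exact hFj) hXY)
  · exact le_int_of_abs_sub_lt (n := x 0 + 1) (by push_cast; exact hFj) hX |>.trans (by push_cast; rfl)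

/-! ### Cells at mesh `δ` -/

/-- Membership in a segment with endpoints scaled by a real `δ ≠ 0`. [folklore] -/
theorem mem_segment_ofReal_mul_iff {δ : ℝ} (hδ : δ ≠ 0) {P Q z : ℂ} :
    z ∈ segment ℝ ((δ : ℂ) * P) ((δ : ℂ) * Q) ↔ (δ⁻¹ : ℂ) * z ∈ segment ℝ P Q := by
  have hδ' : (δ : ℂ) ≠ 0 := Complex.ofReal_ne_zero.2 hδ
  constructor
  · rintro ⟨a, b, ha, hb, hab, rfl⟩
    refine ⟨a, b, ha, hb, hab, ?_⟩
    simp only [Complex.real_smul]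
    field_simp
  · rintro ⟨a, b, ha, hb, hab, h⟩
    refine ⟨a, b, ha, hb, hab, ?_⟩
    simp only [Complex.real_smul] at h ⊢
    calc (a : ℂ) * (δ * P) + b * (δ * Q) = δ * (a * P + b * Q) := by ring
      _ = δ * ((δ : ℂ)⁻¹ * z) := by rw [h]
      _ = z := by field_simp

/-- A side at mesh `δ`: the segment between the mesh points of its endpoints. [folklore] -/
theorem mem_side_mesh_iff {δ : ℝ} (hδ : δ ≠ 0) {F : HexVertex} {j : Fin 3} {z : ℂ} :
    z ∈ segment ℝ (triMeshPoint δ (faceVertex F (j + 1))) (triMeshPoint δ (faceVertex F (j + 2))) ↔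
      (δ⁻¹ : ℂ) * z ∈ triSide F j := by
  rw [triMeshPoint, triMeshPoint, mem_segment_ofReal_mul_iff hδ]
  rfl

end Literature.Probability.Percolation
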